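import Mathlib.Analysis.Complex.Basic
import Mathlib.Topology.UnitInterval
import Mathlib.Topology.Homeomorph.Lemmas
import Mathlib.Topology.Order.Compact
import Mathlib.Topology.Order.ProjIcc
import HarnessLib

/-!
# Trimming a Jordan arc to an annulus, and images of Jordan arcs

Two elementary constructions on Jordan arcs in the plane (`e : [0,1] ≃ₜ L`, `L ⊆ ℂ`):

* `exists_arc_of_injective` — a continuous injective map `[0,1] → ℂ` parametrises a Jordan arc
  (a homeomorphism onto its range: compact to Hausdorff);
* `exists_image_arc` — the image of a Jordan arc under a map continuous and injective on it is
  a Jordan arc, parametrised compatibly;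
* `exists_subarc_crossing` — **trimming to an annulus**: if `‖e 0‖ ≥ r₂ > r₁ ≥ ‖e 1‖`, a
  sub-arc of `L` runs from the circle of radius `r₂` to the circle of radius `r₁` inside the
  closed annulus `{r₁ ≤ ‖z‖ ≤ r₂}` (last exit from `{‖z‖ ≥ r₂}`, then first entrance into
  `{‖z‖ ≤ r₁}`).

All folklore.
-/

noncomputable section

open Set Filter Topology Function unitInterval

open scoped unitInterval

namespace Literature.Topology.PlaneTopology

/-- **A continuous injective map of `[0,1]` into `ℂ` is a Jordan arc**: there is a
homeomorphism `e : [0,1] ≃ₜ range g` with `e t = g t`. [folklore] -/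
theorem exists_arc_of_injective {g : I → ℂ} (hg : Continuous g) (hinj : Injective g) :
    ∃ e : I ≃ₜ range g, ∀ t : I, ((e t : range g) : ℂ) = g t := by
  set f : I ≃ range g := Equiv.ofInjective g hinj with hf
  have hfc : Continuous f := by
    rw [hf]
    exact hg.subtype_mk _
  exact ⟨hfc.homeoOfEquivCompactToT2, fun t ↦ rfl⟩

/-- **The image of a Jordan arc under a map continuous and injective on it is a Jordan arc**,
with the parametrisation `t ↦ Φ (e t)`. [folklore] -/
theorem exists_image_arc {L : Set ℂ} (e : I ≃ₜ L) {Φ : ℂ → ℂ} (hΦc : ContinuousOn Φ L)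
    (hΦi : InjOn Φ L) :
    ∃ e' : I ≃ₜ (Φ '' L), ∀ t : I, ((e' t : Φ '' L) : ℂ) = Φ (e t) := by
  set g : I → ℂ := fun t ↦ Φ (e t) with hg
  have hgc : Continuous g :=
    hΦc.comp_continuous (continuous_subtype_val.comp e.continuous) fun t ↦ (e t).2
  have hginj : Injective g := fun t₁ t₂ h ↦
    e.injective (Subtype.ext (hΦi (e t₁).2 (e t₂).2 h))
  have hrange : range g = Φ '' L := by
    ext w
    constructor
    · rintro ⟨t, rfl⟩; exact ⟨e t, (e t).2, rfl⟩
    · rintro ⟨z, hz, rfl⟩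
      exact ⟨e.symm ⟨z, hz⟩, by simp [hg]⟩
  obtain ⟨e₀, he₀⟩ := exists_arc_of_injective hgc hginj
  refine ⟨e₀.trans (Homeomorph.setCongr hrange), fun t ↦ ?_⟩
  simp only [Homeomorph.trans_apply]
  have : (((Homeomorph.setCongr hrange) (e₀ t) : Φ '' L) : ℂ) = ((e₀ t : range g) : ℂ) := rfl
  rw [this, he₀ t]

/-- **Trimming a Jordan arc to an annulus.** If `‖e 0‖ ≥ r₂ > r₁ ≥ ‖e 1‖` (`0 ≤ r₁`), some
sub-arc of `L` starts on the circle of radius `r₂`, ends on the circle of radius `r₁`, and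
stays in the closed annulus between them. [folklore] -/
theorem exists_subarc_crossing {L : Set ℂ} (e : I ≃ₜ L) {r₁ r₂ : ℝ} (hr : r₁ < r₂)
    (h0 : r₂ ≤ ‖((e 0 : L) : ℂ)‖) (h1 : ‖((e 1 : L) : ℂ)‖ ≤ r₁) :
    ∃ (L' : Set ℂ) (e' : I ≃ₜ L'), L' ⊆ L ∧ ‖((e' 0 : L') : ℂ)‖ = r₂ ∧ ‖((e' 1 : L') : ℂ)‖ = r₁ ∧
      ∀ z ∈ L', r₁ ≤ ‖z‖ ∧ ‖z‖ ≤ r₂ := by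
  -- the path as a function of a real parameter
  set F : ℝ → ℂ := fun t ↦ ((e (projIcc 0 1 zero_le_one t) : L) : ℂ) with hF
  have hFc : Continuous F := continuous_subtype_val.comp (e.continuous.comp continuous_projIcc)
  have hFmem : ∀ t, F t ∈ L := fun t ↦ (e _).2
  have hFinj : InjOn F (Icc 0 1) := by
    intro s hs t ht hst
    have h := e.injective (Subtype.ext hst)
    have := congrArg Subtype.val h
    simpa [projIcc_of_mem _ hs, projIcc_of_mem _ ht] using this
  set f : ℝ → ℝ := fun t ↦ ‖F t‖ with hf
  have hfc : Continuous f := continuous_norm.comp hFc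
  have hf0 : r₂ ≤ f 0 := by
    rw [hf]; dsimp only; rw [hF]; dsimp only
    rwa [projIcc_left]
  have hf1 : f 1 ≤ r₁ := by
    rw [hf]; dsimp only; rw [hF]; dsimp only
    rwa [projIcc_right]
  -- last exit `t₀` from `{f ≥ r₂}`
  set S₀ : Set ℝ := {t | t ∈ Icc (0 : ℝ) 1 ∧ r₂ ≤ f t} with hS₀
  have hS₀c : IsClosed S₀ := by
    have : S₀ = Icc (0 : ℝ) 1 ∩ f ⁻¹' Ici r₂ := by ext t; simp [hS₀]
    rw [this]; exact isClosed_Icc.inter (isClosed_Ici.preimage hfc)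
  have hS₀ne : S₀.Nonempty := ⟨0, ⟨le_rfl, zero_le_one⟩, hf0⟩
  have hS₀bdd : BddAbove S₀ := ⟨1, fun t ht ↦ ht.1.2⟩
  set t₀ : ℝ := sSup S₀ with ht₀
  have ht₀S : t₀ ∈ S₀ := hS₀c.csSup_mem hS₀ne hS₀bdd
  have ht₀1 : t₀ < 1 := by
    rcases ht₀S.1.2.eq_or_lt with h | h
    · exfalso; have := ht₀S.2; rw [h] at this; linarith
    · exact h
  have hafter₀ : ∀ t ∈ Ioc t₀ 1, f t < r₂ := fun t ht ↦ by
    by_contra hge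
    rw [not_lt] at hge
    have : t ≤ t₀ := le_csSup hS₀bdd ⟨⟨ht₀S.1.1.trans ht.1.le, ht.2⟩, hge⟩
    linarith [ht.1]
  have hft₀ : f t₀ = r₂ := by
    refine le_antisymm ?_ ht₀S.2
    -- `f ≤ r₂` just after `t₀`, and `f` is continuous
    have hcl : t₀ ∈ closure (Ioc t₀ 1) := by
      rw [closure_Ioc ht₀1.ne]; exact ⟨le_rfl, ht₀1.le⟩
    have hsub : Ioc t₀ 1 ⊆ f ⁻¹' Iic r₂ := fun t ht ↦ (hafter₀ t ht).le
    exact closure_minimal hsub (isClosed_Iic.preimage hfc) hcl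
  -- first entrance `t₁` into `{f ≤ r₁}` after `t₀`
  set S₁ : Set ℝ := {t | t ∈ Icc t₀ 1 ∧ f t ≤ r₁} with hS₁
  have hS₁c : IsClosed S₁ := by
    have : S₁ = Icc t₀ 1 ∩ f ⁻¹' Iic r₁ := by ext t; simp [hS₁]
    rw [this]; exact isClosed_Icc.inter (isClosed_Iic.preimage hfc)
  have hS₁ne : S₁.Nonempty := ⟨1, ⟨ht₀1.le, le_rfl⟩, hf1⟩
  have hS₁bdd : BddBelow S₁ := ⟨t₀, fun t ht ↦ ht.1.1⟩
  set t₁ : ℝ := sInf S₁ with ht₁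
  have ht₁S : t₁ ∈ S₁ := hS₁c.csInf_mem hS₁ne hS₁bdd
  have ht₀₁ : t₀ < t₁ := by
    rcases ht₁S.1.1.eq_or_lt with h | h
    · exfalso; have := ht₁S.2; rw [← h, hft₀] at this; linarith
    · exact h
  have hbefore₁ : ∀ t ∈ Ico t₀ t₁, r₁ < f t := fun t ht ↦ by
    by_contra hle
    rw [not_lt] at hle
    have : t₁ ≤ t := csInf_le hS₁bdd ⟨⟨ht.1, ht.2.le.trans ht₁S.1.2⟩, hle⟩
    linarith [ht.2]
  have hft₁ : f t₁ = r₁ := by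
    refine le_antisymm ht₁S.2 ?_
    have hcl : t₁ ∈ closure (Ico t₀ t₁) := by
      rw [closure_Ico ht₀₁.ne]; exact ⟨ht₀₁.le, le_rfl⟩
    have hsub : Ico t₀ t₁ ⊆ f ⁻¹' Ici r₁ := fun t ht ↦ (hbefore₁ t ht).le
    exact closure_minimal hsub (isClosed_Ici.preimage hfc) hcl
  have hann : ∀ t ∈ Icc t₀ t₁, r₁ ≤ f t ∧ f t ≤ r₂ := fun t ht ↦ by
    constructor
    · rcases ht.2.eq_or_lt with h | h
      · rw [h, hft₁]
      · exact (hbefore₁ t ⟨ht.1, h⟩).le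
    · rcases ht.1.eq_or_lt with h | h
      · rw [← h, hft₀]
      · exact (hafter₀ t ⟨h, ht.2.trans ht₁S.1.2⟩).le
  -- the sub-arc, parametrised by `[0,1]`
  have ht₀0 : 0 ≤ t₀ := ht₀S.1.1
  have ht₁1 : t₁ ≤ 1 := ht₁S.1.2
  set g : I → ℂ := fun s ↦ F (t₀ + (s : ℝ) * (t₁ - t₀)) with hg
  have hgmem : ∀ s : I, t₀ + (s : ℝ) * (t₁ - t₀) ∈ Icc t₀ t₁ := fun s ↦ by
    constructor
    · nlinarith [s.2.1, ht₀₁]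
    · nlinarith [s.2.2, ht₀₁]
  have hgc : Continuous g :=
    hFc.comp (continuous_const.add ((continuous_subtype_val).mul continuous_const))
  have hginj : Injective g := by
    intro s₁ s₂ h
    have hm₁ := hgmem s₁
    have hm₂ := hgmem s₂
    have h' := hFinj ⟨ht₀0.trans hm₁.1, hm₁.2.trans ht₁1⟩ ⟨ht₀0.trans hm₂.1, hm₂.2.trans ht₁1⟩ h
    have : (s₁ : ℝ) = s₂ := by
      have hne : t₁ - t₀ ≠ 0 := by linarith
      have := mul_right_cancel₀ hne (by linarith : (s₁ : ℝ) * (t₁ - t₀) = s₂ * (t₁ - t₀))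
      exact this
    exact Subtype.ext this
  obtain ⟨e', he'⟩ := exists_arc_of_injective hgc hginj
  refine ⟨range g, e', ?_, ?_, ?_, ?_⟩
  · rintro _ ⟨s, rfl⟩; exact hFmem _
  · rw [he']; show f (t₀ + ((0 : I) : ℝ) * (t₁ - t₀)) = r₂
    simp [hft₀]
  · rw [he']; show f (t₀ + ((1 : I) : ℝ) * (t₁ - t₀)) = r₁
    simp [hft₁]
  · rintro _ ⟨s, rfl⟩
    exact hann _ (hgmem s)

end Literature.Topology.PlaneTopology
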